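import Mathlib

/-!
# The viscous kink layer: sup-gradient diverges, weighted gradient vanishes

Solo-blind programme, steady door R4c, paper §24.17 (g-vii)(5′)/(6′).

Model for the leaf-function response across a Thomas–Fermi contact: `u - ℓ² u'' = ½ sign x`
(a unit jump of the data at the contact), `ℓ = (ν / c_a)^{1/2}`.  Its solution is
`u = ½ sign x (1 - exp (-|x|/ℓ))`, with gradient profile `u'(x) = exp (-|x|/ℓ) / (2ℓ)`
(`kinkLayerGrad`).  We record the dichotomy used to retype hypothesis (c2)₁ in weighted form:

* `kinkLayerGrad_at_zero`, `kinkLayerGrad_le` : the sup of the gradient is `1/(2ℓ)` — it DIVERGES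
  as `ℓ → 0` (i.e. `ν → 0`);
* `integral_mul_kinkLayerGrad_Ioi` : the gradient weighted by the distance to the contact (the
  Thomas–Fermi pattern vanishes linearly there, `q ~ s · dist`) integrates to `ℓ/2` per side — it
  VANISHES as `ℓ → 0`;
* `integral_kinkLayerGrad_sq_Ioi` : the layer energy `∫ u'² = 1/(8ℓ)` per side, so `ν ∫ u'²`
  `= ν/(8ℓ) = (ν c_a)^{1/2}/8` stays bounded — the energy bound of `SoloBlindSingularLayer` is sharp;
* `kinkLayer_branch_solves` : on `x > 0` the branch `U(x) = (1 - exp(-x/ℓ))/2` satisfies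
  `U - ℓ² U'' = 1/2` with `U' = kinkLayerGrad ℓ`.
-/

namespace Summit.AnomalousDissipation.AnomalousDissipation.Theorems

open Real MeasureTheory Set

/-- Gradient profile of the viscous kink layer of width `ℓ`. -/
noncomputable def kinkLayerGrad (ℓ x : ℝ) : ℝ := Real.exp (-|x| / ℓ) / (2 * ℓ)

/-- The gradient at the contact: `u'(0) = 1/(2ℓ)`. -/
theorem kinkLayerGrad_at_zero (ℓ : ℝ) : kinkLayerGrad ℓ 0 = 1 / (2 * ℓ) := by
  simp [kinkLayerGrad]

/-- The gradient profile is nonnegative. -/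
theorem kinkLayerGrad_nonneg (ℓ : ℝ) (hℓ : 0 < ℓ) (x : ℝ) : 0 ≤ kinkLayerGrad ℓ x := by
  unfold kinkLayerGrad; positivity

/-- The sup of the gradient is attained at the contact and equals `1/(2ℓ)`. -/
theorem kinkLayerGrad_le (ℓ : ℝ) (hℓ : 0 < ℓ) (x : ℝ) : kinkLayerGrad ℓ x ≤ 1 / (2 * ℓ) := by
  unfold kinkLayerGrad
  have h : Real.exp (-|x| / ℓ) ≤ 1 := by
    rw [Real.exp_le_one_iff]
    exact div_nonpos_of_nonpos_of_nonneg (by linarith [abs_nonneg x]) hℓ.le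
  gcongr

/-- Distance-weighted gradient on one side of the contact: `∫₀^∞ x u'(x) dx = ℓ/2`. -/
theorem integral_mul_kinkLayerGrad_Ioi (ℓ : ℝ) (hℓ : 0 < ℓ) :
    ∫ x in Ioi (0:ℝ), x * kinkLayerGrad ℓ x = ℓ / 2 := by
  have h1 : ∀ x ∈ Ioi (0:ℝ),
      x * kinkLayerGrad ℓ x = (1 / (2 * ℓ)) * (x ^ ((2:ℝ) - 1) * Real.exp (-((1 / ℓ) * x))) := by
    intro x hx
    have hx' : 0 < x := hx
    rw [kinkLayerGrad, abs_of_pos hx', show -x / ℓ = -((1 / ℓ) * x) by ring,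
      show (2:ℝ) - 1 = 1 by norm_num, Real.rpow_one]
    ring
  rw [setIntegral_congr_fun measurableSet_Ioi h1, integral_const_mul,
    Real.integral_rpow_mul_exp_neg_mul_Ioi (by norm_num : (0:ℝ) < 2) (by positivity : 0 < 1 / ℓ),
    Real.Gamma_two]
  rw [one_div_one_div, Real.rpow_two]
  field_simp

/-- Layer energy on one side: `∫₀^∞ u'(x)² dx = 1/(8ℓ)`. -/
theorem integral_kinkLayerGrad_sq_Ioi (ℓ : ℝ) (hℓ : 0 < ℓ) :
    ∫ x in Ioi (0:ℝ), (kinkLayerGrad ℓ x) ^ 2 = 1 / (8 * ℓ) := by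
  have h1 : ∀ x ∈ Ioi (0:ℝ),
      (kinkLayerGrad ℓ x) ^ 2 = (1 / (4 * ℓ ^ 2)) * Real.exp ((-2 / ℓ) * x) := by
    intro x hx
    have hx' : 0 < x := hx
    rw [kinkLayerGrad, abs_of_pos hx', div_pow, ← Real.exp_nat_mul]
    rw [show ((2:ℕ):ℝ) * (-x / ℓ) = (-2 / ℓ) * x by push_cast; ring]
    ring
  rw [setIntegral_congr_fun measurableSet_Ioi h1, integral_const_mul,
    integral_exp_mul_Ioi (div_neg_of_neg_of_pos (by norm_num) hℓ : (-2) / ℓ < 0) 0]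
  rw [mul_zero, Real.exp_zero]
  field_simp
  ring

/-- The smooth branch on `x > 0`: `U = (1 - exp(-x/ℓ))/2` has `U' = kinkLayerGrad ℓ` there and
solves `U - ℓ² U'' = 1/2`. -/
theorem kinkLayer_branch_solves (ℓ : ℝ) (hℓ : 0 < ℓ) (x : ℝ) (hx : 0 < x) :
    HasDerivAt (fun y => (1 - Real.exp (-y / ℓ)) / 2) (kinkLayerGrad ℓ x) x ∧
    HasDerivAt (fun y => Real.exp (-y / ℓ) / (2 * ℓ)) (-(Real.exp (-x / ℓ)) / (2 * ℓ ^ 2)) x ∧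
    (1 - Real.exp (-x / ℓ)) / 2 - ℓ ^ 2 * (-(Real.exp (-x / ℓ)) / (2 * ℓ ^ 2)) = 1 / 2 := by
  have hℓ0 : ℓ ≠ 0 := hℓ.ne'
  -- derivative of y ↦ -y/ℓ
  have hlin : ∀ y : ℝ, HasDerivAt (fun y => -y / ℓ) (-1 / ℓ) y := by
    intro y
    have := ((hasDerivAt_id y).neg).div_const ℓ
    simpa using this
  have hexp : HasDerivAt (fun y => Real.exp (-y / ℓ)) (Real.exp (-x / ℓ) * (-1 / ℓ)) x :=
    (Real.hasDerivAt_exp _).comp x (hlin x)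
  refine ⟨?_, ?_, ?_⟩
  · have h := ((hasDerivAt_const x (1:ℝ)).sub hexp).div_const 2
    have e : (0 - Real.exp (-x / ℓ) * (-1 / ℓ)) / 2 = kinkLayerGrad ℓ x := by
      rw [kinkLayerGrad, abs_of_pos hx]; field_simp; ring
    rw [← e]; exact h
  · have h := hexp.div_const (2 * ℓ)
    have e : Real.exp (-x / ℓ) * (-1 / ℓ) / (2 * ℓ) = -(Real.exp (-x / ℓ)) / (2 * ℓ ^ 2) := by
      field_simp
    rw [← e]; exact h
  · field_simp; ring

/-- The dichotomy in one line: sup-gradient `1/(2ℓ)` (divergent as `ℓ → 0`) versus distance-weighted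
gradient `ℓ/2` and `ν`-weighted energy `ν/(8ℓ)` (both harmless). -/
theorem kinkLayer_dichotomy (ℓ : ℝ) (hℓ : 0 < ℓ) :
    kinkLayerGrad ℓ 0 = 1 / (2 * ℓ) ∧ (∫ x in Ioi (0:ℝ), x * kinkLayerGrad ℓ x) = ℓ / 2 ∧
    (∫ x in Ioi (0:ℝ), (kinkLayerGrad ℓ x) ^ 2) = 1 / (8 * ℓ) :=
  ⟨kinkLayerGrad_at_zero ℓ, integral_mul_kinkLayerGrad_Ioi ℓ hℓ, integral_kinkLayerGrad_sq_Ioi ℓ hℓ⟩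

end Summit.AnomalousDissipation.AnomalousDissipation.Theorems
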